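import Literature.Barriers.CriticalPhenomena.LaceExpansionIsingDeconvolutionParts
import Mathlib.Analysis.Calculus.IteratedDeriv.Lemmas
import Mathlib.Analysis.Calculus.Deriv.Pi
import HarnessLib

/-!
# Liu–Slade 2026, Proposition 1.2 (1.9) decomposed along its printed proof (§5):
# the objects, the three inputs as named facts, and the proved assembly

Barrier catalogue `Literature/Barriers/CriticalPhenomena/` (D-0021), companion of
`LaceExpansionIsingDeconvolutionParts.lean`, which vendors Liu–Slade 2026, Proposition 1.2, first
display (1.9) — "Let `d > 2`, `ε > 0`, and `L ≥ L₀`. Then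
`S_1(x) = δ_{0,x} + C_1(x)/σ² + O(1/(L^{1-ε}⟦x⟧^{d-1}))`, with the constant uniform in `L`" — as
the named fact `SpreadOutIsing.LiuSlade2026_prop12_asymp` over the tree's series objects
`soGreen d L 1 = Σ_n D^{*n}` (`D = soStep d L`, the punctured cube), `srwGreen d = Σ_n D_nn^{*n}`,
`soVariance`, `delta0`, `jnorm`.

The printed proof (§5 of the source) is: with `A = δ - D_nn`, `F = δ - D`, `E = A - σ^{-2}F`,
`f = C_1 * E * S_1`, one has `S_1 = δ + σ^{-2}C_1 + φ`, `φ = D * f - σ^{-2} C_1 * F` ((5.2)–(5.4));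
**Lemma 5.1**: `φ̂` is `d - 1` times (weakly) differentiable on `𝕋^d` with
`‖∇^α φ̂‖_{L¹(𝕋^d)} ≲ L^{-(1-ε)}` for `|α| ≤ d - 1`; and **Lemma 3.1** (= Liu–Slade 2024, Lemma 2.2:
decay of Fourier coefficients from integrable derivatives, "an elementary proof is given in
[LS24a]"): `|h(x)| ≤ c_{d,a} ⟦x⟧^{-a} max_{|α| ∈ {0,a}} ‖∇^α ĥ‖_1`. Hence
`φ(x) = O(L^{-(1-ε)}⟦x⟧^{-(d-1)})`, which is (1.9).

This file records that architecture in Lean, in the CLASSICAL form in which it will be proved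
(the tree has no weak derivatives on `𝕋^d`; none are needed, because only pure derivatives
`∂^m/∂k_j^m`, `m ∈ {0, d-1}`, along one axis enter the proof of Lemma 3.1, and `φ̂` is real-analytic
off `k = 0`):

* `soPhiHat d L k = 1/(1 - D̂(k)) - 1 - σ^{-2} d/ε(k)` — the Fourier transform `φ̂` of
  `φ = S_1 - δ - σ^{-2}C_1` on the cube `[-π,π]^d` (`Ŝ_1 = 1/(1 - D̂)` by (1.7), `δ̂ = 1`,
  `Ĉ_1 = 1/(1 - D̂_nn) = d/ε`, `ε(k) = Σ_i (1 - cos k_i)` the tree's `dispersion`, `D̂ = soSymbol`);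
  by (5.2)–(5.4) this is the source's `φ̂ = D̂ f̂ - σ^{-2} Ĉ_1 F̂ = f̂ - 1`, `f̂ = Ê/(Â F̂)`;
* `soPhiHatD d L j m k = ∂^m φ̂/∂k_j^m (k)` — its `m`-th partial derivative along the axis `j`
  (Mathlib's `iteratedDeriv` of the fibre `t ↦ φ̂(k with k_j := t)`), a classical derivative at
  every `k ∈ [-π,π]^d` off the `j`-axis (`soPhiHatD_hasDerivAt`), `2π`-periodic in `k_j`
  (`soPhiHatD_periodic`);
* NAMED FACTS (the three inputs, each over these objects, each true as stated and to be discharged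
  in sibling files): `LiuSlade2026_prop12_fourierRep` — the Fourier representation
  `S_1(x) - δ_{0,x} - C_1(x)/σ² = ∫_{[-π,π]^d} φ̂(k) cos(k·x) dk/(2π)^d` with `φ̂ ∈ L¹` ((1.4),
  (1.6)–(1.8), (5.4); for the tree's series `S_1`, `C_1` this is Fourier inversion plus
  `Σ_n D̂ⁿ = 1/(1 - D̂)` under the integral, `d > 2`); `LiuSlade2026_lem31_fiber` — Lemma 3.1 for
  one axis in classical form (`|x_j|^a |∫ g cos(k·x)| ≤ ‖∂_j^a g‖_1` for a `2π`-periodic-in-`k_j`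
  family of fibrewise derivatives: Fubini and `a` integrations by parts on almost every fibre, no
  boundary terms); `LiuSlade2026_lem51_L1` — Lemma 5.1 (5.5) for pure derivatives in classical
  form (`∫_{[-π,π]^d} |∂_j^m φ̂| ≤ C_ε L^{-(1-ε)}`, `m ≤ d - 1`, `L ≥ L₀`);
* PROVED: the assembly `LiuSlade2026_prop12_asymp_of_parts : fourierRep → lem31 → lem51 →
  LiuSlade2026_prop12_asymp` ("Proof of Proposition 1.2 assuming Lemma 5.1", §5: Lemma 3.1 with
  `a = d - 1` along the axis of the largest coordinate of `x`, and with `a = 0`), including the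
  regularity of `φ̂` along fibres that Lemma 3.1 consumes.

What is deliberately NOT here: the proofs of the three named facts (sibling `…Prop12*.lean`
files), the second display (1.10) of Prop. 1.2 (`LiuSlade2026_prop12_greenBound`, parent file), and
the weak-derivative / `L^p` formalism of Liu–Slade 2024, §2 (not needed in this classical route).

## References

* Y. Liu, G. Slade, *Gaussian deconvolution and the lace expansion for spread-out models*,
  Ann. Inst. H. Poincaré Probab. Statist. 62 (2026), arXiv:2310.07640: (1.4), (1.6)–(1.8),
  Prop. 1.2 with (1.9); Lemma 3.1 with (3.7); §5: (5.2)–(5.4), Lemma 5.1 with (5.5), "Proof of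
  Proposition 1.2 assuming Lemma 5.1" [LiuSlade2026]. Equation numbers are those of the arXiv
  version held in the literature store.
* Y. Liu, G. Slade, *Gaussian deconvolution and the lace expansion*, Probab. Theory Related
  Fields 195 (2024), arXiv:2310.07635: Lemma 2.2 and App. A (the elementary proof of Lemma 3.1)
  [LiuSlade2024].
-/

noncomputable section

namespace Literature.Barriers.CriticalPhenomena.SpreadOutIsing

open Filter Finset Literature.Probability.LatticeModels Real
open _root_.MeasureTheory _root_.Topology

variable {d L : ℕ}

/-! ## Part A. The objects: `φ̂` and its pure partial derivatives -/

/-- The Fourier transform `φ̂(k) = 1/(1 - D̂(k)) - 1 - σ^{-2}·(ε(k)/d)^{-1}` on `[-π,π]^d` of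
`φ = S_1 - δ - σ^{-2}C_1` ((5.4): `S_1 = δ + σ^{-2}C_1 + φ`), written with the symbols
`Ŝ_1 = 1/(1 - D̂)` ((1.7), `D̂ = soSymbol d L`), `δ̂ = 1`, and
`Ĉ_1 = 1/(1 - D̂_nn) = (ε/d)^{-1}` (`D̂_nn(k) = d^{-1}Σ_j cos k_j`, (5.8); `ε = dispersion`). Equal to
the source's `φ̂ = D̂f̂ - σ^{-2}Ĉ_1F̂ = f̂ - 1`, `f̂ = Ê/(ÂF̂)` ((5.2)–(5.4)). Junk value at the
points `k ∈ (2πℤ)^d` where the denominators vanish (Lean's `0⁻¹ = 0`; a null set).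
[cite: LiuSlade2026, (5.2)–(5.4) with (1.7) and (5.8)] -/
def soPhiHat (d L : ℕ) (k : Fin d → ℝ) : ℝ :=
  (1 - soSymbol d L k)⁻¹ - 1 - (soVariance d L)⁻¹ * (dispersion k / d)⁻¹

/-- The pure partial derivative `∂^m φ̂/∂k_j^m (k)` of `φ̂ = soPhiHat d L` along the axis `j`:
the `m`-th derivative at `t = k_j` of the fibre `t ↦ φ̂(k₁,…,k_{j-1},t,k_{j+1},…,k_d)` (Mathlib's
`iteratedDeriv`; a genuine derivative wherever the fibre avoids `(2πℤ)^d`, in particular at every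
`k ∈ [-π,π]^d` off the `j`-axis, see `soPhiHatD_hasDerivAt`). These are the (weak = classical)
derivatives `∇^α φ̂`, `α = m e_j`, of Lemma 5.1. [cite: LiuSlade2026, Lemma 5.1 (the derivatives φ̂_α)] -/
def soPhiHatD (d L : ℕ) (j : Fin d) (m : ℕ) (k : Fin d → ℝ) : ℝ :=
  iteratedDeriv m (fun t => soPhiHat d L (Function.update k j t)) (k j)

/-- `∂^0 φ̂ = φ̂`. [cite: LiuSlade2026, Lemma 5.1] -/
theorem soPhiHatD_zero (j : Fin d) : soPhiHatD d L j 0 = soPhiHat d L := by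
  funext k
  simp [soPhiHatD]

/-- Along the fibre through `k`, `t ↦ ∂_j^m φ̂ (k with k_j := t)` is the `m`-th derivative of the
fibre function `t ↦ φ̂(k with k_j := t)`. [folklore] -/
theorem soPhiHatD_update (j : Fin d) (m : ℕ) (k : Fin d → ℝ) (t : ℝ) :
    soPhiHatD d L j m (Function.update k j t) =
      iteratedDeriv m (fun s => soPhiHat d L (Function.update k j s)) t := by
  unfold soPhiHatD
  simp only [Function.update_idem, Function.update_self]

/-! ### Periodicity in `k_j` -/

/-- `k·y` changes by `2π y_j` when `k_j` is increased by `2π`. [folklore] -/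
theorem kdot_update_add_two_pi (k : Fin d → ℝ) (j : Fin d) (t : ℝ) (y : Site d) :
    kdot (Function.update k j (t + 2 * π)) y = kdot (Function.update k j t) y + (y j : ℤ) * (2 * π) := by
  unfold kdot
  rw [← Finset.sum_erase_add _ _ (Finset.mem_univ j), ← Finset.sum_erase_add _ _ (Finset.mem_univ j)]
  have h : ∀ i ∈ Finset.univ.erase j,
      Function.update k j (t + 2 * π) i * (y i : ℝ) = Function.update k j t i * (y i : ℝ) := by
    intro i hi
    rw [Function.update_of_ne (Finset.ne_of_mem_erase hi), Function.update_of_ne (Finset.ne_of_mem_erase hi)]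
  rw [Finset.sum_congr rfl h]
  simp only [Function.update_self]
  ring

/-- `D̂` is `2π`-periodic in each coordinate (`y ∈ ℤ^d`). [folklore] -/
theorem soSymbol_update_add_two_pi (k : Fin d → ℝ) (j : Fin d) (t : ℝ) :
    soSymbol d L (Function.update k j (t + 2 * π)) = soSymbol d L (Function.update k j t) := by
  unfold soSymbol
  refine Finset.sum_congr rfl fun y _ => ?_
  rw [kdot_update_add_two_pi, Real.cos_add_int_mul_two_pi]

/-- `ε(k) = Σ_i (1 - cos k_i)` is `2π`-periodic in each coordinate. [folklore] -/
theorem dispersion_update_add_two_pi (k : Fin d → ℝ) (j : Fin d) (t : ℝ) :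
    dispersion (Function.update k j (t + 2 * π)) = dispersion (Function.update k j t) := by
  unfold dispersion
  refine Finset.sum_congr rfl fun i _ => ?_
  by_cases hi : i = j
  · subst hi
    simp only [Function.update_self]
    rw [show t + 2 * π = t + (1 : ℤ) * (2 * π) by push_cast; ring, Real.cos_add_int_mul_two_pi]
  · rw [Function.update_of_ne hi, Function.update_of_ne hi]

/-- `φ̂` is `2π`-periodic in each coordinate. [cite: LiuSlade2026, (1.4) (functions on 𝕋^d = (ℝ/2πℤ)^d)] -/
theorem soPhiHat_update_add_two_pi (k : Fin d → ℝ) (j : Fin d) (t : ℝ) :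
    soPhiHat d L (Function.update k j (t + 2 * π)) = soPhiHat d L (Function.update k j t) := by
  unfold soPhiHat
  rw [soSymbol_update_add_two_pi, dispersion_update_add_two_pi]

/-- **Periodicity of the derivatives**: `∂_j^m φ̂` is `2π`-periodic in `k_j`.
[cite: LiuSlade2026, (1.4) (functions on 𝕋^d)] -/
theorem soPhiHatD_periodic (j : Fin d) (m : ℕ) (k : Fin d → ℝ) :
    soPhiHatD d L j m (Function.update k j (k j + 2 * π)) = soPhiHatD d L j m k := by
  rw [soPhiHatD_update]
  have hper : (fun s => soPhiHat d L (Function.update k j (s + 2 * π))) =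
      fun s => soPhiHat d L (Function.update k j s) :=
    funext fun s => soPhiHat_update_add_two_pi k j s
  have h := congrFun (iteratedDeriv_comp_add_const m (fun s => soPhiHat d L (Function.update k j s))
    (2 * π)) (k j)
  rw [hper] at h
  rw [← h]
  rfl

/-! ### Smoothness of the fibres off the `j`-axis -/

/-- On `[-π,π]^d`, a point off the `j`-axis has a coordinate `i ≠ j` with `cos k_i < 1`, so the
dispersion is positive along the whole fibre `{k_j := t}`. [folklore] -/
theorem dispersion_update_pos {k : Fin d → ℝ} (hk : k ∈ cube d) {j : Fin d}
    (hk0 : Function.update k j 0 ≠ 0) (t : ℝ) : 0 < dispersion (Function.update k j t) := by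
  -- a coordinate `i ≠ j` with `k i ≠ 0`
  obtain ⟨i, hi⟩ : ∃ i, Function.update k j 0 i ≠ 0 := by
    by_contra h
    push Not at h
    exact hk0 (funext h)
  have hij : i ≠ j := by
    rintro rfl
    simp at hi
  rw [Function.update_of_ne hij] at hi
  have hki : k i ∈ Set.Icc (-π) π := hk i (Set.mem_univ _)
  have hcos : Real.cos (k i) < 1 := by
    refine lt_of_le_of_ne (Real.cos_le_one _) fun h => hi ?_
    have hπ := Real.pi_pos
    exact (Real.cos_eq_one_iff_of_lt_of_lt (by linarith [hki.1]) (by linarith [hki.2])).1 h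
  unfold dispersion
  calc (0 : ℝ) < 1 - Real.cos (k i) := by linarith
    _ = 1 - Real.cos (Function.update k j t i) := by rw [Function.update_of_ne hij]
    _ ≤ ∑ l, (1 - Real.cos (Function.update k j t l)) :=
        Finset.single_le_sum (f := fun l => 1 - Real.cos (Function.update k j t l))
          (fun l _ => sub_nonneg.2 (Real.cos_le_one _)) (Finset.mem_univ i)

/-- Off the `j`-axis of `[-π,π]^d`, `1 - D̂ > 0` along the whole fibre (the tree's infrared bound
`1 - D̂ ≥ (2/N_L) ε`, `mul_dispersion_le_one_sub_soSymbol`, valid on all of `ℝ^d`). [folklore] -/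
theorem one_sub_soSymbol_update_pos (hd : 1 ≤ d) (hL : 1 ≤ L) {k : Fin d → ℝ} (hk : k ∈ cube d)
    {j : Fin d} (hk0 : Function.update k j 0 ≠ 0) (t : ℝ) :
    0 < 1 - soSymbol d L (Function.update k j t) := by
  have hN : (0 : ℝ) < soCount d L := by exact_mod_cast soCount_pos hd hL
  have h := mul_dispersion_le_one_sub_soSymbol hd hL (Function.update k j t)
  have hε := dispersion_update_pos hk hk0 t
  exact lt_of_lt_of_le (by positivity) h

/-- `t ↦ D̂(k with k_j := t)` is smooth (a trigonometric polynomial in `t`). [folklore] -/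
theorem contDiff_soSymbol_update (k : Fin d → ℝ) (j : Fin d) :
    ContDiff ℝ ⊤ fun t => soSymbol d L (Function.update k j t) := by
  unfold soSymbol kdot
  refine ContDiff.sum fun y _ => contDiff_const.mul (Real.contDiff_cos.comp ?_)
  refine ContDiff.sum fun i _ => ContDiff.mul ?_ contDiff_const
  exact (contDiff_apply ℝ ℝ i).comp (contDiff_update ⊤ k j)

/-- `t ↦ ε(k with k_j := t)` is smooth. [folklore] -/
theorem contDiff_dispersion_update (k : Fin d → ℝ) (j : Fin d) :
    ContDiff ℝ ⊤ fun t => dispersion (Function.update k j t) := by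
  unfold dispersion
  refine ContDiff.sum fun i _ => contDiff_const.sub (Real.contDiff_cos.comp ?_)
  exact (contDiff_apply ℝ ℝ i).comp (contDiff_update ⊤ k j)

/-- **Smoothness of the fibres**: off the `j`-axis of `[-π,π]^d` (and for `d, L ≥ 1`), the fibre
`t ↦ φ̂(k with k_j := t)` is `C^∞` on `ℝ` (both denominators are positive along it).
[cite: LiuSlade2026, §5 (φ̂ = D̂f̂ - σ^{-2}Ĉ_1F̂ is smooth off k = 0)] -/
theorem contDiff_soPhiHat_update (hd : 1 ≤ d) (hL : 1 ≤ L) {k : Fin d → ℝ} (hk : k ∈ cube d)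
    {j : Fin d} (hk0 : Function.update k j 0 ≠ 0) :
    ContDiff ℝ ⊤ fun t => soPhiHat d L (Function.update k j t) := by
  unfold soPhiHat
  refine ((ContDiff.inv ?_ ?_).sub contDiff_const).sub (contDiff_const.mul (ContDiff.inv ?_ ?_))
  · exact contDiff_const.sub (contDiff_soSymbol_update k j)
  · exact fun t => (one_sub_soSymbol_update_pos hd hL hk hk0 t).ne'
  · exact (contDiff_dispersion_update k j).div_const _
  · intro t
    have hd' : (0 : ℝ) < d := by exact_mod_cast hd
    exact (div_pos (dispersion_update_pos hk hk0 t) hd').ne'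

/-- **The derivatives along a fibre**: off the `j`-axis of `[-π,π]^d`, `∂_j^{m+1} φ̂ (k)` is the
derivative at `t = k_j` of `t ↦ ∂_j^m φ̂ (k with k_j := t)`. [cite: LiuSlade2026, Lemma 5.1 (φ̂ is (d-1) times differentiable)] -/
theorem soPhiHatD_hasDerivAt (hd : 1 ≤ d) (hL : 1 ≤ L) (j : Fin d) (m : ℕ) {k : Fin d → ℝ}
    (hk : k ∈ cube d) (hk0 : Function.update k j 0 ≠ 0) :
    HasDerivAt (fun t => soPhiHatD d L j m (Function.update k j t)) (soPhiHatD d L j (m + 1) k) (k j) := by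
  have hfun : (fun t => soPhiHatD d L j m (Function.update k j t)) =
      iteratedDeriv m (fun s => soPhiHat d L (Function.update k j s)) :=
    funext fun t => soPhiHatD_update j m k t
  rw [hfun, soPhiHatD, iteratedDeriv_succ]
  exact (((contDiff_soPhiHat_update hd hL hk hk0).differentiable_iteratedDeriv m
    (WithTop.coe_lt_top _)) _).hasDerivAt

/-! ## Part B. The three inputs, as named facts -/

/-- NAMED FACT — **the Fourier representation of `φ = S_1 - δ - σ^{-2}C_1`** (Liu–Slade 2026,
(1.4), (1.6)–(1.8) and (5.4)): for `d > 2` and `L ≥ 1`, `φ̂ = soPhiHat d L` is integrable on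
`[-π,π]^d` and, for every `x ∈ ℤ^d`,
`S_1(x) - δ_{0,x} - C_1(x)/σ² = ∫_{[-π,π]^d} φ̂(k) cos(k·x) dk/(2π)^d`.
For the tree's series objects `S_1 = Σ_n D^{*n}` (`soGreen d L 1`) and `C_1 = Σ_n D_nn^{*n}`
(`srwGreen d`) this is the source's definition (1.7) of `S_μ` by the Fourier integral read as a
theorem: term-by-term Fourier inversion `D^{*n}(x) = ∫ D̂ⁿ cos(k·x) dk/(2π)^d` (the tree's
`convPow_eq_integral`) and `Σ_n D̂ⁿ = 1/(1 - D̂)` under the integral by dominated convergence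
(`|Σ_{n<M} D̂ⁿ| ≤ 2/(1 - D̂) ∈ L¹` for `d > 2`), likewise for `D_nn` with `1/(1 - D̂_nn) = d/ε`, and
`∫ cos(k·x) dk = (2π)^d δ_{0,x}`. Not proved here. [cite: LiuSlade2026, (1.4), (1.6)–(1.8) and (5.4)] -/
def LiuSlade2026_prop12_fourierRep : Prop :=
  ∀ d : ℕ, 3 ≤ d → ∀ L : ℕ, 1 ≤ L →
    IntegrableOn (soPhiHat d L) (cube d) volume ∧
    ∀ x : Site d, soGreen d L 1 x - delta0 x - srwGreen d x / soVariance d L =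
      ((2 * π) ^ d)⁻¹ * ∫ k in cube d, soPhiHat d L k * Real.cos (kdot k x)

/-- NAMED FACT — **Liu–Slade 2026, Lemma 3.1** (= Liu–Slade 2024, Lemma 2.2: "if the weak derivative
`ĥ_α` is in `L¹(𝕋^d)` for all multi-indices `α` with `|α| ≤ a` then
`|h(x)| ≤ c_{d,a} ⟦x⟧^{-a} max_{|α| ∈ {0,a}} ‖ĥ_α‖_1`"), in the classical one-axis form that its
elementary proof (Liu–Slade 2024, App. A: `a` integrations by parts in `k_j`, no boundary terms on
the torus) yields and that the proof of Prop. 1.2 consumes: let `d ≥ 2`, `j` an axis, `a ≥ 0`, and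
`g_0, g_1, …, g_a` real functions on `ℝ^d` such that `g_0` and `g_a` are integrable on `[-π,π]^d`,
`g_{m+1}(k)` is the derivative at `t = k_j` of `t ↦ g_m(k with k_j := t)` for every `m < a` and every
`k ∈ [-π,π]^d` off the `j`-axis (a null set of fibres is allowed to be singular), and each `g_m` is
`2π`-periodic in `k_j`; then for every `x ∈ ℤ^d`,
`|x_j|^a |∫_{[-π,π]^d} g_0(k) cos(k·x) dk| ≤ ∫_{[-π,π]^d} |g_a(k)| dk`.
(Fubini over the fibres `{k_j := t}` and, on almost every fibre, `a` integrations by parts of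
`cos(t x_j + c)` against the periodic `g_m`.) Not proved here.
[cite: LiuSlade2026, Lemma 3.1 with (3.7)] [cite: LiuSlade2024, Lemma 2.2 and Appendix A] -/
def LiuSlade2026_lem31_fiber : Prop :=
  ∀ d : ℕ, 2 ≤ d → ∀ (j : Fin d) (a : ℕ) (g : ℕ → (Fin d → ℝ) → ℝ),
    IntegrableOn (g 0) (cube d) volume → IntegrableOn (g a) (cube d) volume →
    (∀ m < a, ∀ k ∈ cube d, Function.update k j 0 ≠ 0 →
        HasDerivAt (fun t => g m (Function.update k j t)) (g (m + 1) k) (k j)) →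
    (∀ m ≤ a, ∀ k ∈ cube d, g m (Function.update k j (k j + 2 * π)) = g m k) →
    ∀ x : Site d, |((x j : ℤ) : ℝ)| ^ a * |∫ k in cube d, g 0 k * Real.cos (kdot k x)| ≤
      ∫ k in cube d, |g a k|

/-- NAMED FACT — **Liu–Slade 2026, Lemma 5.1** ("Let `ε > 0`. If `L ≥ L₀` with `L₀` sufficiently
large (depending only on `d, v`), then … `φ̂` is `d - 1` times weakly differentiable, and for any
multi-index `α` with `|α| ≤ d - 1`, `‖φ̂_α‖_1 ≲ L^{-(1-ε)}` (5.5), with the constant independent of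
`L` but depends on `ε`"), for the pure derivatives `α = m e_j` in classical form
(`φ̂_α = soPhiHatD d L j m`, a classical derivative off the null `j`-axis, `soPhiHatD_hasDerivAt`):
for `d > 2` and `ε > 0` there are `C` and `L₀ ≥ 1` such that for all `L ≥ L₀`, all axes `j` and all
`m ≤ d - 1`, `∂_j^m φ̂` is integrable on `[-π,π]^d` with `∫_{[-π,π]^d} |∂_j^m φ̂| ≤ C/L^{1-ε}`. (Here
`v` is the punctured cube, so `L₀ = L₀(d, ε)`.) The source's proof: Lemma 5.2, Hölder, and Lemma 3.6
(decay of `D`, the infrared bound `1 - D̂ ≳ L²|k|² ∧ 1` of [HS02], `‖D̂_α‖_q ≲ L^{|α|-d/q}`); for the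
punctured cube all of this is explicit (`D̂ = ((2L+1)^d Π_i D_L(k_i) - 1)/N_L` with the Dirichlet
kernel `D_L`). Not proved here. [cite: LiuSlade2026, Lemma 5.1 with (5.5), Lemma 5.2, Lemma 3.6] -/
def LiuSlade2026_lem51_L1 : Prop :=
  ∀ d : ℕ, 3 ≤ d → ∀ ε : ℝ, 0 < ε → ∃ C : ℝ, ∃ L₀ : ℕ, 1 ≤ L₀ ∧ ∀ L : ℕ, L₀ ≤ L →
    ∀ (j : Fin d) (m : ℕ), m ≤ d - 1 →
      IntegrableOn (soPhiHatD d L j m) (cube d) volume ∧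
      ∫ k in cube d, |soPhiHatD d L j m k| ≤ C / (L : ℝ) ^ (1 - ε)

/-! ## Part C. The assembly: Proposition 1.2 (1.9) from the three inputs -/

/-- The largest coordinate controls the Euclidean norm: `|x| ≤ d · max_j |x_j|`, in the form
"`|x| ≤ d |x_{j⋆}|` for a maximising index `j⋆`" (`d ≥ 1`). [folklore] -/
theorem exists_euclidNorm_le_mul_abs (hd : 1 ≤ d) (x : Site d) :
    ∃ j : Fin d, euclidNorm x ≤ d * |((x j : ℤ) : ℝ)| := by
  haveI : Nonempty (Fin d) := ⟨⟨0, hd⟩⟩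
  obtain ⟨j, -, hj⟩ := Finset.exists_max_image Finset.univ (fun i => |((x i : ℤ) : ℝ)|)
    Finset.univ_nonempty
  refine ⟨j, ?_⟩
  have hM : 0 ≤ |((x j : ℤ) : ℝ)| := abs_nonneg _
  have hsum : ∑ i, ((x i : ℤ) : ℝ) ^ 2 ≤ d * |((x j : ℤ) : ℝ)| ^ 2 := by
    calc ∑ i, ((x i : ℤ) : ℝ) ^ 2 ≤ ∑ _i : Fin d, |((x j : ℤ) : ℝ)| ^ 2 := by
          refine Finset.sum_le_sum fun i _ => ?_
          rw [← sq_abs]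
          exact pow_le_pow_left₀ (abs_nonneg _) (hj i (Finset.mem_univ _)) 2
      _ = d * |((x j : ℤ) : ℝ)| ^ 2 := by simp
  have hd1 : (1 : ℝ) ≤ d := by exact_mod_cast hd
  unfold euclidNorm
  calc √(∑ i, ((x i : ℤ) : ℝ) ^ 2) ≤ √((d * |((x j : ℤ) : ℝ)|) ^ 2) := by
        refine Real.sqrt_le_sqrt (hsum.trans ?_)
        rw [mul_pow]
        refine mul_le_mul_of_nonneg_right ?_ (by positivity)
        calc (d : ℝ) = d * 1 := (mul_one _).symm
          _ ≤ d * d := mul_le_mul_of_nonneg_left hd1 (by positivity)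
          _ = (d : ℝ) ^ 2 := (sq _).symm
    _ = d * |((x j : ℤ) : ℝ)| := Real.sqrt_sq (by positivity)

/-- **Liu–Slade 2026, Proposition 1.2 (1.9), assembled from its printed inputs** ("Proof of
Proposition 1.2 assuming Lemma 5.1. It follows from Lemma 3.1 and (5.5) that
`φ(x) = O(L^{-(1-ε)}⟦x⟧^{-(d-1)})`, which implies (5.1)" = (1.9)): the Fourier representation of
`φ = S_1 - δ - σ^{-2}C_1`, Lemma 3.1 (one axis, classical) and Lemma 5.1 (pure derivatives,
classical) imply `LiuSlade2026_prop12_asymp`. Lemma 3.1 is applied with `a = 0` (giving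
`|φ(x)| ≤ ‖φ̂‖_1/(2π)^d`) and with `a = d - 1` along an axis `j⋆` maximising `|x_j|` (giving
`|x_{j⋆}|^{d-1}|φ(x)| ≤ ‖∂_{j⋆}^{d-1}φ̂‖_1/(2π)^d`, and `⟦x⟧ ≤ d|x_{j⋆}| ∨ 1`).
[cite: LiuSlade2026, §5, Proof of Proposition 1.2 assuming Lemma 5.1] -/
theorem LiuSlade2026_prop12_asymp_of_parts (h₁ : LiuSlade2026_prop12_fourierRep)
    (h₂ : LiuSlade2026_lem31_fiber) (h₃ : LiuSlade2026_lem51_L1) : LiuSlade2026_prop12_asymp := by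
  intro d hd ε hε
  obtain ⟨C₃, L₀, hL₀, h3⟩ := h₃ d (by omega) ε hε
  have hd1 : 1 ≤ d := by omega
  set A : ℝ := ((2 * π) ^ d)⁻¹ with hA
  have hApos : 0 < A := by rw [hA]; positivity
  refine ⟨A * ((d : ℝ) ^ (d - 1) + 1) * C₃, L₀, fun L hL x => ?_⟩
  have hL1 : 1 ≤ L := hL₀.trans hL
  have hLpos : (0 : ℝ) < L := by exact_mod_cast hL1
  obtain ⟨hint, hrep⟩ := h₁ d (by omega) L hL1
  -- the Fourier representation
  set I : ℝ := ∫ k in cube d, soPhiHat d L k * Real.cos (kdot k x) with hI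
  have hφ : soGreen d L 1 x - delta0 x - srwGreen d x / soVariance d L = A * I := hrep x
  -- the bound `B = C₃ / L^{1-ε}` on the two `L¹` norms
  set B : ℝ := C₃ / (L : ℝ) ^ (1 - ε) with hB
  have hLrpow : 0 < (L : ℝ) ^ (1 - ε) := Real.rpow_pos_of_pos hLpos _
  -- (a) `a = 0`: `|I| ≤ ∫ |φ̂| ≤ B`
  obtain ⟨hint0, hbd0⟩ := h3 L hL ⟨0, by omega⟩ 0 (Nat.zero_le _)
  rw [soPhiHatD_zero] at hint0 hbd0
  have hI0 : |I| ≤ B := by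
    calc |I| ≤ ∫ k in cube d, |soPhiHat d L k * Real.cos (kdot k x)| := by
          rw [hI]; exact abs_integral_le_integral_abs
      _ ≤ ∫ k in cube d, |soPhiHat d L k| := by
          refine integral_mono_of_nonneg (ae_of_all _ fun k => abs_nonneg _) hint0.abs
            (ae_of_all _ fun k => ?_)
          show |soPhiHat d L k * Real.cos (kdot k x)| ≤ |soPhiHat d L k|
          rw [abs_mul]
          exact mul_le_of_le_one_right (abs_nonneg _) (Real.abs_cos_le_one _)
      _ ≤ B := hbd0
  have hB0 : 0 ≤ B := le_trans (abs_nonneg _) hI0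
  -- (b) `a = d - 1` along a maximising axis `j⋆`: `|x_{j⋆}|^{d-1} |I| ≤ B`
  obtain ⟨j, hj⟩ := exists_euclidNorm_le_mul_abs hd1 x
  obtain ⟨hinta, hbda⟩ := h3 L hL j (d - 1) le_rfl
  have hIa : |((x j : ℤ) : ℝ)| ^ (d - 1) * |I| ≤ B := by
    have h := h₂ d (by omega) j (d - 1) (fun m => soPhiHatD d L j m)
      (by rw [soPhiHatD_zero]; exact hint0) hinta
      (fun m _ k hk hk0 => soPhiHatD_hasDerivAt hd1 hL1 j m hk hk0)
      (fun m _ k _ => soPhiHatD_periodic j m k) x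
    rw [soPhiHatD_zero] at h
    exact h.trans hbda
  -- (c) `⟦x⟧^{d-1} |I| ≤ (d^{d-1} + 1) B`
  have hJ : jnorm x ^ (d - 1) * |I| ≤ ((d : ℝ) ^ (d - 1) + 1) * B := by
    have hI_nn : 0 ≤ |I| := abs_nonneg _
    have h1 : euclidNorm x ^ (d - 1) * |I| ≤ (d : ℝ) ^ (d - 1) * B := by
      calc euclidNorm x ^ (d - 1) * |I| ≤ (d * |((x j : ℤ) : ℝ)|) ^ (d - 1) * |I| := by
            refine mul_le_mul_of_nonneg_right ?_ hI_nn
            exact pow_le_pow_left₀ (euclidNorm_nonneg x) hj _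
        _ = (d : ℝ) ^ (d - 1) * (|((x j : ℤ) : ℝ)| ^ (d - 1) * |I|) := by rw [mul_pow]; ring
        _ ≤ (d : ℝ) ^ (d - 1) * B := mul_le_mul_of_nonneg_left hIa (by positivity)
    have h2 : (1 : ℝ) ^ (d - 1) * |I| ≤ 1 * B := by rw [one_pow]; exact le_of_eq_of_le rfl (by linarith)
    unfold jnorm
    rcases le_total (euclidNorm x) 1 with hle | hle
    · rw [max_eq_right hle]
      calc (1 : ℝ) ^ (d - 1) * |I| ≤ 1 * B := h2
        _ ≤ ((d : ℝ) ^ (d - 1) + 1) * B := by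
            refine mul_le_mul_of_nonneg_right ?_ hB0
            have : (0 : ℝ) ≤ (d : ℝ) ^ (d - 1) := by positivity
            linarith
    · rw [max_eq_left hle]
      calc euclidNorm x ^ (d - 1) * |I| ≤ (d : ℝ) ^ (d - 1) * B := h1
        _ ≤ ((d : ℝ) ^ (d - 1) + 1) * B := by
            refine mul_le_mul_of_nonneg_right ?_ hB0
            linarith
  -- (d) conclusion
  have hJpos : 0 < jnorm x ^ ((d : ℝ) - 1) := Real.rpow_pos_of_pos (jnorm_pos x) _
  have hrpow : jnorm x ^ ((d : ℝ) - 1) = jnorm x ^ (d - 1) := by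
    rw [show (d : ℝ) - 1 = ((d - 1 : ℕ) : ℝ) by rw [Nat.cast_sub hd1, Nat.cast_one],
      Real.rpow_natCast]
  rw [hφ, le_div_iff₀ (mul_pos hLrpow hJpos), hrpow, abs_mul, abs_of_pos hApos]
  calc A * |I| * ((L : ℝ) ^ (1 - ε) * jnorm x ^ (d - 1))
      = A * (L : ℝ) ^ (1 - ε) * (jnorm x ^ (d - 1) * |I|) := by ring
    _ ≤ A * (L : ℝ) ^ (1 - ε) * (((d : ℝ) ^ (d - 1) + 1) * B) :=
        mul_le_mul_of_nonneg_left hJ (by positivity)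
    _ = A * ((d : ℝ) ^ (d - 1) + 1) * C₃ := by
        rw [hB]
        field_simp

end Literature.Barriers.CriticalPhenomena.SpreadOutIsing

end
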